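import Summits.SmoothPoincare4.SmoothPoincare4.Theorems.SymplecticOrigamiGromovRecognitionRelEndStubCapModelX2

/-!
# Wedge cap for `GromovRecognitionRelEnd` — `X = M ∪ Cap` is compact, connected, second countable
(stub `stub_capModel` of line `cross-cap-laurent`, crux `SymplecticOrigami.GromovRecognitionRelEnd`,
item stmt-SmoothPoincare4-11009)

* COMPACT: `X` is covered by the images of the compact truncation `K ∪ {‖ψ‖ ≤ 3R₁}` (H5) and of
  three compact polydiscs `QV = {|u|² ≤ 1/(4R₁²), |z₂|² ≤ 4R₁²}`, `QH`, `QC` of the charts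
  (`max(|z₁|², |z₂|²) > 4R₁²` when `‖z‖ > 3R₁`);
* SECOND COUNTABLE: a compact manifold glued from second countable models
  (`SmoothGlueData.secondCountableTopology`);
* CONNECTED: `M` is connected and its image is dense (axis points of the charts are limits of
  off-axis points, which are points of the end).
-/

noncomputable section

-- the registered namespace `Summit.SmoothPoincare4.SmoothPoincare4.Theorems…` repeats a component
set_option linter.dupNamespace false

open scoped Manifold ContDiff Topology
open Set Function Filter TopologicalSpace Literature.Geometry.Kaehler Literature.Geometry.Symplectic
  Literature.Topology.FourManifolds

namespace Summit.SmoothPoincare4.SmoothPoincare4.Theorems.GromovRecognitionRelEnd.CrossCapLaurent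

namespace CapModel

/-- Model space `ℝ⁴ = ℂ²` (coordinates `0,1` = `z₁`, `2,3` = `z₂`). -/
local notation "E4" => EuclideanSpace ℝ (Fin 4)

variable {R₁ : ℝ} [hR : Fact (0 < R₁)]

/-! ## Compact polydiscs in the charts -/

/-- `(4R₁²)⁻¹ < R₁⁻²`. [folklore] -/
theorem quarter_lt : (4 * R₁ ^ 2)⁻¹ < R₁⁻¹ ^ 2 := by
  have h := hR.out
  rw [inv_pow]
  exact inv_strictAnti₀ (by positivity) (by nlinarith)

omit hR in
/-- A closed bounded "polydisc" `{r1 ≤ a, r2 ≤ b}` of `ℝ⁴` is compact. [folklore] -/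
theorem isCompact_polydisc (a b : ℝ) : IsCompact {p : E4 | r1 p ≤ a ∧ r2 p ≤ b} := by
  refine Metric.isCompact_of_isClosed_isBounded ((isClosed_le continuous_r1 continuous_const).inter
    (isClosed_le continuous_r2 continuous_const)) ?_
  refine (Metric.isBounded_closedBall (x := (0 : E4)) (r := Real.sqrt (|a| + |b|))).subset ?_
  rintro p ⟨h1, h2⟩
  rw [Metric.mem_closedBall, dist_zero_right]
  refine Real.le_sqrt_of_sq_le ?_
  rw [norm_sq_eq_r1_add_r2]
  exact add_le_add (h1.trans (le_abs_self a)) (h2.trans (le_abs_self b))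

omit hR in
/-- A subset of an open piece which is a polydisc of `ℝ⁴` inside the piece is compact. [folklore] -/
theorem isCompact_of_val_image {U : Opens E4} {Q : Set U} {a b : ℝ}
    (h : Subtype.val '' Q = {p : E4 | r1 p ≤ a ∧ r2 p ≤ b}) : IsCompact Q := by
  rw [Topology.IsInducing.subtypeVal.isCompact_iff]
  exact h ▸ isCompact_polydisc a b

variable (R₁) in
/-- The compact polydisc of the `V`-chart. [folklore] -/
def QV : Set (OV R₁) := {b | r1 b.1 ≤ (4 * R₁ ^ 2)⁻¹ ∧ r2 b.1 ≤ 4 * R₁ ^ 2}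
variable (R₁) in
/-- The compact polydisc of the `H`-chart. [folklore] -/
def QH : Set (OH R₁) := {b | r1 b.1 ≤ 4 * R₁ ^ 2 ∧ r2 b.1 ≤ (4 * R₁ ^ 2)⁻¹}
variable (R₁) in
/-- The compact polydisc of the corner chart. [folklore] -/
def QC : Set (OC R₁) := {c | r1 c.1 ≤ (4 * R₁ ^ 2)⁻¹ ∧ r2 c.1 ≤ (4 * R₁ ^ 2)⁻¹}

/-- `QV` is compact. [folklore] -/
theorem isCompact_QV : IsCompact (QV R₁) := by
  refine isCompact_of_val_image (a := (4 * R₁ ^ 2)⁻¹) (b := 4 * R₁ ^ 2) ?_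
  ext p; constructor
  · rintro ⟨b, hb, rfl⟩; exact hb
  · intro hp; exact ⟨⟨p, mem_OV.2 (lt_of_le_of_lt hp.1 quarter_lt)⟩, hp, rfl⟩
/-- `QH` is compact. [folklore] -/
theorem isCompact_QH : IsCompact (QH R₁) := by
  refine isCompact_of_val_image (a := 4 * R₁ ^ 2) (b := (4 * R₁ ^ 2)⁻¹) ?_
  ext p; constructor
  · rintro ⟨b, hb, rfl⟩; exact hb
  · intro hp; exact ⟨⟨p, mem_OH.2 (lt_of_le_of_lt hp.2 quarter_lt)⟩, hp, rfl⟩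
/-- `QC` is compact. [folklore] -/
theorem isCompact_QC : IsCompact (QC R₁) := by
  refine isCompact_of_val_image (a := (4 * R₁ ^ 2)⁻¹) (b := (4 * R₁ ^ 2)⁻¹) ?_
  ext p; constructor
  · rintro ⟨b, hb, rfl⟩; exact hb
  · intro hp
    exact ⟨⟨p, mem_OC.2 ⟨lt_of_le_of_lt hp.1 quarter_lt, lt_of_le_of_lt hp.2 quarter_lt⟩⟩, hp, rfl⟩

variable (R₁) in
/-- **The compact core of the cap.** [folklore] -/
def KB : Set (Cap R₁) := (κV '' QV R₁ ∪ κH '' QH R₁) ∪ κC '' QC R₁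

/-- `KB` is compact. [folklore] -/
theorem isCompact_KB : IsCompact (KB R₁) :=
  ((isCompact_QV.image (((dC1 R₁).continuous_inl).comp (dVH R₁).continuous_inl)).union
    (isCompact_QH.image (((dC1 R₁).continuous_inl).comp (dVH R₁).continuous_inr))).union
    (isCompact_QC.image (dC1 R₁).continuous_inr)

/-- A `V`-chart point with `|z₂|² > R₁²` is the corner-chart point `(u, 1/z₂)`. [folklore] -/
theorem κV_eq_κC {b : OV R₁} (h2 : R₁ ^ 2 < r2 b.1) : κV b = (κC (mkC (inv2 b.1)) : Cap R₁) :=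
  (κC_eq_κV_iff.2 ⟨h2, rfl⟩).symm
/-- An `H`-chart point with `|z₁|² > R₁²` is the corner-chart point `(1/z₁, t)`. [folklore] -/
theorem κH_eq_κC {b : OH R₁} (h1 : R₁ ^ 2 < r1 b.1) : κH b = (κC (mkC (inv1 b.1)) : Cap R₁) :=
  (κC_eq_κH_iff.2 ⟨h1, rfl⟩).symm

/-- `R₁² < 4R₁²`. [folklore] -/
theorem sq_lt_four_sq : R₁ ^ 2 < 4 * R₁ ^ 2 := by have := hR.out; nlinarith

/-- From `4R₁² < s`: `s⁻¹ ≤ (4R₁²)⁻¹`. [folklore] -/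
theorem inv_le_quarter {s : ℝ} (h : 4 * R₁ ^ 2 < s) : s⁻¹ ≤ (4 * R₁ ^ 2)⁻¹ :=
  inv_anti₀ (by have := hR.out; positivity) h.le

/-! ## The cover of `X` by the two compact sets -/

variable {M : Type} [TopologicalSpace M] [T2Space M] [ChartedSpace E4 M] [IsManifold (𝓡 4) ∞ M]
  {sf : MForm (𝓡 4) M ℝ 2} {K : Set M} {R : ℝ} {ψ : M → E4} {χ : E4 → M}
  {J : AlmostComplexStructure (𝓡 4) ∞ M} (H : EndHyp sf K R ψ χ R₁ J)

/-- **Finite points of the cap are points of `M`**: `inr (ofCoord w) = inl (χ w)`. [folklore] -/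
theorem inr_ofCoord {w : E4} (hw : w ∈ goodSet R₁) : (dX H).inr (ofCoord w) = (dX H).inl (χ w) := by
  obtain ⟨hK, hψ⟩ := H.χ_spec (H.lt_norm_of_good hw).2
  rw [eq_comm, (dX H).inl_eq_inr_iff, mem_dX_source, dX_glue_apply, hψ]
  exact ⟨⟨hK, hw⟩, rfl⟩

/-- The compact truncation of `M`. [folklore] -/
def KA (_ : EndHyp sf K R ψ χ R₁ J) : Set M := K ∪ {x | ‖ψ x‖ ≤ 3 * R₁}

omit hR [T2Space M] in
/-- `KA` is compact (H5). [folklore] -/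
theorem isCompact_KA : IsCompact (KA H) :=
  H.ends _ (by have := H.lt_R₁; have := H.R₁_pos; linarith)

/-- Cover, points of `M`. [folklore] -/
theorem cover_inl (x : M) : (dX H).inl x ∈ (dX H).inl '' KA H ∪ (dX H).inr '' KB R₁ := by
  by_cases hK : x ∈ K
  · exact Or.inl ⟨x, Or.inl hK, rfl⟩
  by_cases hn : ‖ψ x‖ ≤ 3 * R₁
  · exact Or.inl ⟨x, Or.inr hn, rfl⟩
  right
  set w := ψ x with hw
  have hpos := hR.out
  have h9 : 9 * R₁ ^ 2 < r1 w + r2 w := by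
    rw [← norm_sq_eq_r1_add_r2]; nlinarith [not_le.1 hn, norm_nonneg w]
  have hsrc : ∀ hg : w ∈ goodSet R₁, (dX H).inl x = (dX H).inr (ofCoord w) := fun hg =>
    ((dX H).inr_glue (show x ∈ (dX H).glue.source from ⟨hK, hg⟩)).symm
  by_cases h1 : 4 * R₁ ^ 2 < r1 w
  · have hg : w ∈ goodSet R₁ := Or.inl (sq_lt_four_sq.trans h1)
    have h1' : R₁ ^ 2 < r1 w := sq_lt_four_sq.trans h1
    rw [hsrc hg, ofCoord_of_r1 h1']
    have hbV : (mkV (inv1 w) : OV R₁).1 = inv1 w := val_toOpens (r1_inv1_lt hpos h1')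
    by_cases h2 : r2 w ≤ 4 * R₁ ^ 2
    · refine ⟨_, Or.inl (Or.inl ⟨mkV (inv1 w), ?_, rfl⟩), rfl⟩
      show r1 (mkV (inv1 w) : OV R₁).1 ≤ _ ∧ r2 (mkV (inv1 w) : OV R₁).1 ≤ _
      rw [hbV, r1_inv1, r2_inv1]; exact ⟨inv_le_quarter h1, h2⟩
    · have h2' : 4 * R₁ ^ 2 < r2 w := not_le.1 h2
      have hr2 : R₁ ^ 2 < r2 (inv1 w) := by rw [r2_inv1]; exact sq_lt_four_sq.trans h2'
      rw [κV_eq_κC (by rw [hbV]; exact hr2)]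
      refine ⟨_, Or.inr ⟨mkC (inv2 (mkV (inv1 w) : OV R₁).1), ?_, rfl⟩, rfl⟩
      show r1 (mkC _ : OC R₁).1 ≤ _ ∧ r2 (mkC _ : OC R₁).1 ≤ _
      rw [hbV, mkC, val_toOpens (inv2_mapsV (r1_inv1_lt hpos h1') hr2).1, r1_inv2, r1_inv1,
        r2_inv2, r2_inv1]
      exact ⟨inv_le_quarter h1, inv_le_quarter h2'⟩
  · have h2 : 4 * R₁ ^ 2 < r2 w := by
      by_contra h; nlinarith [not_lt.1 h, not_lt.1 h1, hpos]
    have hg : w ∈ goodSet R₁ := Or.inr (sq_lt_four_sq.trans h2)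
    have h2' : R₁ ^ 2 < r2 w := sq_lt_four_sq.trans h2
    rw [hsrc hg, ofCoord_of_r2 h2']
    have hbH : (mkH (inv2 w) : OH R₁).1 = inv2 w := val_toOpens (r2_inv2_lt hpos h2')
    refine ⟨_, Or.inl (Or.inr ⟨mkH (inv2 w), ?_, rfl⟩), rfl⟩
    show r1 (mkH (inv2 w) : OH R₁).1 ≤ _ ∧ r2 (mkH (inv2 w) : OH R₁).1 ≤ _
    rw [hbH, r1_inv2, r2_inv2]; exact ⟨not_lt.1 h1, inv_le_quarter h2⟩

/-- Cover, points of the `V`-chart. [folklore] -/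
theorem cover_κV (b : OV R₁) : (dX H).inr (κV b) ∈ (dX H).inl '' KA H ∪ (dX H).inr '' KB R₁ := by
  by_cases h1 : r1 b.1 ≤ (4 * R₁ ^ 2)⁻¹
  · by_cases h2 : r2 b.1 ≤ 4 * R₁ ^ 2
    · exact Or.inr ⟨_, Or.inl (Or.inl ⟨b, ⟨h1, h2⟩, rfl⟩), rfl⟩
    · have h2' : 4 * R₁ ^ 2 < r2 b.1 := not_le.1 h2
      rw [κV_eq_κC (sq_lt_four_sq.trans h2')]
      refine Or.inr ⟨_, Or.inr ⟨mkC (inv2 b.1), ?_, rfl⟩, rfl⟩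
      show r1 (mkC _ : OC R₁).1 ≤ _ ∧ r2 (mkC _ : OC R₁).1 ≤ _
      rw [mkC, val_toOpens (inv2_mapsV b.2 (sq_lt_four_sq.trans h2')).1, r1_inv2, r2_inv2]
      exact ⟨h1, inv_le_quarter h2'⟩
  · have h1' : r1 b.1 ≠ 0 := fun h => h1 (by rw [h]; positivity)
    rw [κV_eq_ofCoord h1', inr_ofCoord H (Or.inl (sq_lt_r1_inv1 h1' b.2))]
    exact cover_inl H _

/-- Cover, points of the `H`-chart. [folklore] -/
theorem cover_κH (b : OH R₁) : (dX H).inr (κH b) ∈ (dX H).inl '' KA H ∪ (dX H).inr '' KB R₁ := by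
  by_cases h2 : r2 b.1 ≤ (4 * R₁ ^ 2)⁻¹
  · by_cases h1 : r1 b.1 ≤ 4 * R₁ ^ 2
    · exact Or.inr ⟨_, Or.inl (Or.inr ⟨b, ⟨h1, h2⟩, rfl⟩), rfl⟩
    · have h1' : 4 * R₁ ^ 2 < r1 b.1 := not_le.1 h1
      rw [κH_eq_κC (sq_lt_four_sq.trans h1')]
      refine Or.inr ⟨_, Or.inr ⟨mkC (inv1 b.1), ?_, rfl⟩, rfl⟩
      show r1 (mkC _ : OC R₁).1 ≤ _ ∧ r2 (mkC _ : OC R₁).1 ≤ _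
      rw [mkC, val_toOpens (inv1_mapsH b.2 (sq_lt_four_sq.trans h1')).1, r1_inv1, r2_inv1]
      exact ⟨inv_le_quarter h1', h2⟩
  · have h2' : r2 b.1 ≠ 0 := fun h => h2 (by rw [h]; positivity)
    rw [κH_eq_ofCoord h2', inr_ofCoord H (Or.inr (sq_lt_r2_inv2 h2' b.2))]
    exact cover_inl H _

/-- Cover, points of the corner chart. [folklore] -/
theorem cover_κC (c : OC R₁) : (dX H).inr (κC c) ∈ (dX H).inl '' KA H ∪ (dX H).inr '' KB R₁ := by
  by_cases h1 : r1 c.1 ≤ (4 * R₁ ^ 2)⁻¹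
  · by_cases h2 : r2 c.1 ≤ (4 * R₁ ^ 2)⁻¹
    · exact Or.inr ⟨_, Or.inr ⟨c, ⟨h1, h2⟩, rfl⟩, rfl⟩
    · have h2' : r2 c.1 ≠ 0 := fun h => h2 (by rw [h]; positivity)
      have heq : κC c = (κV (mkV (inv2 c.1)) : Cap R₁) := by
        rw [κC_eq_κV_iff, mkV, val_toOpens (inv2_mapsC c.2 h2').1]
        exact ⟨(inv2_mapsC c.2 h2').2, by
          apply Subtype.ext; rw [mkC, val_toOpens (by rw [inv2_inv2 h2']; exact c.2), inv2_inv2 h2']⟩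
      rw [heq]; exact cover_κV H _
  · have h1' : r1 c.1 ≠ 0 := fun h => h1 (by rw [h]; positivity)
    have heq : κC c = (κH (mkH (inv1 c.1)) : Cap R₁) := by
      rw [κC_eq_κH_iff, mkH, val_toOpens (inv1_mapsC c.2 h1').1]
      exact ⟨(inv1_mapsC c.2 h1').2, by
        apply Subtype.ext; rw [mkC, val_toOpens (by rw [inv1_inv1 h1']; exact c.2), inv1_inv1 h1']⟩
    rw [heq]; exact cover_κH H _

/-- **`X = M ∪ Cap` is compact.** [folklore] -/
theorem compactSpace_X : CompactSpace (dX H).Glued := by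
  refine (dX H).compactSpace_of_subset (isCompact_KA H) isCompact_KB fun y => ?_
  rcases (dX H).exists_inl_or_inr y with ⟨x, rfl⟩ | ⟨c, rfl⟩
  · exact cover_inl H x
  · rcases (dC1 R₁).exists_inl_or_inr c with ⟨y₁, rfl⟩ | ⟨c', rfl⟩
    · rcases (dVH R₁).exists_inl_or_inr y₁ with ⟨b, rfl⟩ | ⟨b, rfl⟩
      · exact cover_κV H b
      · exact cover_κH H b
    · exact cover_κC H c'

/-- **`X` is second countable.** [folklore] -/
theorem secondCountable_X : SecondCountableTopology (dX H).Glued := by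
  haveI := compactSpace_X H
  exact (dX H).secondCountableTopology

end CapModel

/-- **Registered helper sub-goal `helper_capModelCompactModel`** (file `X3` of stub `stub_capModel`): under the
hypotheses of the stub, the glued model `X = M ∪ Cap` is a COMPACT second countable Hausdorff smooth `4`-manifold containing `M` openly. [folklore] -/
theorem helper_capModelCompactModel :
    ∀ (M : Type) [TopologicalSpace M] [T2Space M] [SecondCountableTopology M]
      [ChartedSpace (EuclideanSpace ℝ (Fin 4)) M] [IsManifold (𝓡 4) ∞ M] [ConnectedSpace M]
      (sf : Literature.Geometry.Kaehler.MForm (𝓡 4) M ℝ 2) (K : Set M) (R : ℝ)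
      (ψ : M → EuclideanSpace ℝ (Fin 4)) (χ : EuclideanSpace ℝ (Fin 4) → M),
      Literature.Geometry.Kaehler.IsSmoothForm sf → Literature.Geometry.Kaehler.IsClosedForm sf →
      (∀ x (v : TangentSpace (𝓡 4) x), v ≠ 0 → ∃ w, sf x ![v, w] ≠ 0) →
      (∀ R', R ≤ R' → IsCompact (K ∪ {x | ‖ψ x‖ ≤ R'})) →
      ContMDiffOn (𝓡 4) 𝓘(ℝ, EuclideanSpace ℝ (Fin 4)) ∞ ψ Kᶜ →
      ContMDiffOn 𝓘(ℝ, EuclideanSpace ℝ (Fin 4)) (𝓡 4) ∞ χ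
        (Metric.closedBall (0 : EuclideanSpace ℝ (Fin 4)) R)ᶜ →
      Set.BijOn ψ Kᶜ (Metric.closedBall (0 : EuclideanSpace ℝ (Fin 4)) R)ᶜ →
      (∀ x, x ∈ Kᶜ → χ (ψ x) = x) →
      (∀ x, x ∈ Kᶜ → ∀ v w, sf x ![v, w] = Literature.Geometry.Symplectic.stdSymplecticForm
        (mfderiv (𝓡 4) 𝓘(ℝ, EuclideanSpace ℝ (Fin 4)) ψ x v)
        (mfderiv (𝓡 4) 𝓘(ℝ, EuclideanSpace ℝ (Fin 4)) ψ x w)) →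
      (∀ R', R < R' → IsOpen (K ∪ {x | x ∈ Kᶜ ∧ ‖ψ x‖ < R'})) →
      ∀ (R₁ : ℝ) (J : Literature.Geometry.Symplectic.AlmostComplexStructure (𝓡 4) ∞ M),
      R < R₁ → 0 < R₁ → J.IsTamedBy sf →
      (∀ x, x ∈ Kᶜ → R₁ < ‖ψ x‖ → ∀ (v : TangentSpace (𝓡 4) x) (a : EuclideanSpace ℝ (Fin 4)),
          a = mfderiv (𝓡 4) 𝓘(ℝ, EuclideanSpace ℝ (Fin 4)) ψ x v →
          mfderiv (𝓡 4) 𝓘(ℝ, EuclideanSpace ℝ (Fin 4)) ψ x (J x v) =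
            WithLp.toLp 2 ![-(a 1), a 0, -(a 3), a 2]) →
      ∃ (X : Type) (_ : TopologicalSpace X) (_ : T2Space X) (_ : SecondCountableTopology X)
        (_ : CompactSpace X) (_ : ChartedSpace (EuclideanSpace ℝ (Fin 4)) X) (_ : IsManifold (𝓡 4) ∞ X)
        (ι : M → X), Function.Injective ι ∧ IsOpenMap ι := by
  intro M _ _ _ _ _ _ sf K R ψ χ h2 h3 h4 h5 h6 h7 h8 h9 h10 hopen R₁ J hR₁ hR₁pos hJt hJstd
  haveI : Fact (0 < R₁) := ⟨hR₁pos⟩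
  let H : CapModel.EndHyp sf K R ψ χ R₁ J :=
    { smooth := h2, closed := h3, nondeg := h4, ends := h5, smooth_ψ := h6, smooth_χ := h7, bij := h8,
      left_inv := h9, pullback_eq := h10, isOpen_trunc := hopen, lt_R₁ := hR₁, R₁_pos := hR₁pos,
      tame := hJt, Jstd := hJstd }
  exact ⟨(CapModel.dX H).Glued, inferInstance, CapModel.t2Space_X H, CapModel.secondCountable_X H,
    CapModel.compactSpace_X H, inferInstance, inferInstance,
    (CapModel.dX H).inl, (CapModel.dX H).inl_injective, (CapModel.dX H).isOpenMap_inl⟩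

end Summit.SmoothPoincare4.SmoothPoincare4.Theorems.GromovRecognitionRelEnd.CrossCapLaurent
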